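import Summits.CriticalPhenomena.PercolationContinuityZ3.Theorems.Transplant.KNCells2ChainLocalise
import Summits.CriticalPhenomena.PercolationContinuityZ3.Theorems.Transplant.KNCells2ChainS
import HarnessLib

/-!
# The localisation rounds `ChainPlanar.Loc` as a PLANAR SCHEDULE `ChainPlanar.Schedule` (ruling R2/R3 2026-08-21T05:09:29Z; p1-g9's structure
# p249958): cores = the order intervals of the symmetric boxes `Loc.core`, one region for all rounds (= the prism), constant axis, route = `Loc.core_route`

builds on p205010 (kernel theorem, internal audit signed; external expert review pending) — nothing in this file uses p205010.
Lane `prim-bschramm`, seat `prim-bschramm-p5` (gen 6; (C) column of the D″ order of battle), helper file (`--supports stmt-CriticalPhenomena-4575 --as helper`).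
* `Loc.lo/hi` (corners of `Loc.core`), `Icc_lo_hi` (`rfl`), `Icc_lo_hi_enlarge`;
* **`Loc.schedule (h : LocOK …) a c N : ChainPlanar.Schedule`** — `N + 1` steps, cores `Loc.core 0 … Loc.core (N+1)`, regions and prism
  `Loc.region … (N+1)`, axis `a`, spreads `Wb`; `rfl` unfoldings `schedule_core/_region/_ax/_Wb/_params/_core_zero` and the closed form of the
  last core `schedule_core_last` (`= {|·_a − c_a| ≤ ℓ₀, |·_{a'} − c_{a'}| ≤ W₀ + (N+1) R'}` after enough rounds).
[cite: KozmaNitzan2024, §4 Lemma 12 (pp. 23–25)]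
-/

noncomputable section

namespace Summit.CriticalPhenomena.PercolationContinuityZ3.Theorems

namespace Transplant

namespace ChainPlanar

open Literature.Probability.Percolation Literature.Probability.LatticeModels
open Literature.Probability.Percolation.KozmaNitzan
open Literature.Probability.Percolation.KozmaNitzan.Cells (oth oth_ne eq_oth_of_ne)

namespace Loc

variable {L₀ W₀ : ℤ} {R' ℓ₀ ℓ₁ WM : ℕ} {Wb : ℕ → ℕ} (h : LocOK L₀ W₀ R' ℓ₀ ℓ₁ WM Wb) (a : Fin 2) (c : Site 2) (N : ℕ)

/-- The lower corner of `Loc.core i`. [folklore] -/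
def lo (L₀ W₀ : ℤ) (R' ℓ₀ ℓ₁ WM : ℕ) (a : Fin 2) (c : Site 2) (i : ℕ) : Site 2 :=
  sLo a 1 c (-(L L₀ R' ℓ₀ ℓ₁ i)) (L L₀ R' ℓ₀ ℓ₁ i) (W W₀ R' WM i)

/-- The upper corner of `Loc.core i`. [folklore] -/
def hi (L₀ W₀ : ℤ) (R' ℓ₀ ℓ₁ WM : ℕ) (a : Fin 2) (c : Site 2) (i : ℕ) : Site 2 :=
  sHi a 1 c (-(L L₀ R' ℓ₀ ℓ₁ i)) (L L₀ R' ℓ₀ ℓ₁ i) (W W₀ R' WM i)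

/-- `Icc (lo i) (hi i) = core i`. [folklore] -/
theorem Icc_lo_hi (i : ℕ) : Finset.Icc (lo L₀ W₀ R' ℓ₀ ℓ₁ WM a c i) (hi L₀ W₀ R' ℓ₀ ℓ₁ WM a c i) = core L₀ W₀ R' ℓ₀ ℓ₁ WM a c i := rfl

/-- The `j`-enlargement of `core i` is the symmetric box with both widths `+ j`. [folklore] -/
theorem Icc_lo_hi_enlarge (i j : ℕ) :
    Finset.Icc (lo L₀ W₀ R' ℓ₀ ℓ₁ WM a c i - ((j : ℕ) : Site 2)) (hi L₀ W₀ R' ℓ₀ ℓ₁ WM a c i + ((j : ℕ) : Site 2)) =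
      sBox a 1 c (-(L L₀ R' ℓ₀ ℓ₁ i + j)) (L L₀ R' ℓ₀ ℓ₁ i + j) (W W₀ R' WM i + j) := by
  rw [lo, hi, sBox_enlarge a 1 (Or.inl rfl), show -L L₀ R' ℓ₀ ℓ₁ i - (j : ℤ) = -(L L₀ R' ℓ₀ ℓ₁ i + j) by ring]

include h in
/-- **The localisation rounds as a planar schedule**: `N + 1` steps `0, …, N` with cores `Loc.core 0, …, Loc.core (N+1)`, every region and the
prism equal to `Loc.region … (N+1)`, constant axis `a` and spreads `Wb`, route = `Loc.core_route`. [cite: KozmaNitzan2024, §4 Lemma 12 (pp. 23–25)] -/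
def schedule : Schedule where
  ax := fun _ => a
  lo := lo L₀ W₀ R' ℓ₀ ℓ₁ WM a c
  hi := hi L₀ W₀ R' ℓ₀ ℓ₁ WM a c
  region := fun _ => region L₀ W₀ R' ℓ₀ ℓ₁ WM a c (N + 1)
  prism := region L₀ W₀ R' ℓ₀ ℓ₁ WM a c (N + 1)
  N := N
  R' := R'
  ℓ₀ := ℓ₀
  ℓ₁ := ℓ₁
  Wb := fun _ => Wb
  encl k hk := by
    rw [Icc_lo_hi_enlarge]
    exact enlarge_core_subset_region h (by omega)
  succ k hk := by
    rw [Icc_lo_hi]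
    exact core_subset_region h (by omega)
  sub_prism _ _ := le_rfl
  nonempty k _ := by
    rw [Icc_lo_hi]
    exact core_nonempty h k
  route k hk v hv := by
    rw [Icc_lo_hi_enlarge] at hv
    obtain ⟨ℓ, h0, h1, σ, hσ, hr, τ, hτ, hh⟩ := core_route h (show k + 1 ≤ N + 1 by omega) hv
    exact ⟨ℓ, h0, h1, σ, hσ, hr, τ, hτ, fun y h1' h2' h3' => by rw [Icc_lo_hi]; exact hh y h1' h2' h3'⟩

/-- The cores of the localisation schedule are the round cores. [folklore] -/
@[simp] theorem schedule_core (k : ℕ) : (schedule h a c N).core k = core L₀ W₀ R' ℓ₀ ℓ₁ WM a c k := rfl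

/-- The regions of the localisation schedule. [folklore] -/
@[simp] theorem schedule_region (k : ℕ) : (schedule h a c N).region k = region L₀ W₀ R' ℓ₀ ℓ₁ WM a c (N + 1) := rfl

/-- The axis of the localisation schedule. [folklore] -/
@[simp] theorem schedule_ax (k : ℕ) : (schedule h a c N).ax k = a := rfl

/-- The band spread of the localisation schedule. [folklore] -/
@[simp] theorem schedule_Wb (k : ℕ) : (schedule h a c N).Wb k = Wb := rfl

/-- The parameters of the localisation schedule. [folklore] -/
theorem schedule_params : (schedule h a c N).N = N ∧ (schedule h a c N).R' = R' ∧ (schedule h a c N).ℓ₀ = ℓ₀ ∧ (schedule h a c N).ℓ₁ = ℓ₁ ∧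
    (schedule h a c N).prism = region L₀ W₀ R' ℓ₀ ℓ₁ WM a c (N + 1) :=
  ⟨rfl, rfl, rfl, rfl, rfl⟩

/-- The levels of the localisation schedule are the enlarged round cores. [folklore] -/
theorem schedule_level (k j : ℕ) :
    (schedule h a c N).level k j = sBox a 1 c (-(L L₀ R' ℓ₀ ℓ₁ k + j)) (L L₀ R' ℓ₀ ℓ₁ k + j) (W W₀ R' WM k + j) :=
  Icc_lo_hi_enlarge a c k j

/-- **The first core is the start box** `{|·_a − c_a| ≤ L₀, |·_{a'} − c_{a'}| ≤ W₀}`. [folklore] -/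
theorem schedule_core_zero : (schedule h a c N).core 0 = sBox a 1 c (-L₀) L₀ W₀ := rfl

/-- **The last core after enough rounds** (`L₀ ≤ (N+1)(ℓ₁ − R') + ℓ₀`, `WM ≤ W₀`) is `{|·_a − c_a| ≤ ℓ₀, |·_{a'} − c_{a'}| ≤ W₀ + (N+1) R'}`.
[cite: KozmaNitzan2024, §4 Lemma 12 (pp. 23–25)] -/
theorem schedule_core_last (hN : L₀ ≤ ((N : ℤ) + 1) * (ℓ₁ - R') + ℓ₀) (hW : (WM : ℤ) ≤ W₀) :
    (schedule h a c N).core (N + 1) = sBox a 1 c (-(ℓ₀ : ℤ)) ℓ₀ (W₀ + ((N : ℤ) + 1) * R') := by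
  rw [schedule_core, core, L_eq_ℓ₀ L₀ R' ℓ₀ ℓ₁ h.hR (by omega) (by push_cast; linarith), W_eq W₀ R' WM hW]
  push_cast
  rfl

/-- **Every core lies in the start box widened transversally**: `core k ⊆ {|·_a − c_a| ≤ max L₀ ℓ₀, |·_{a'} − c_{a'}| ≤ W (N+1)}` for `k ≤ N + 1`.
[folklore] -/
theorem schedule_core_subset {k : ℕ} (hk : k ≤ N + 1) :
    (schedule h a c N).core k ⊆ sBox a 1 c (-(max L₀ (ℓ₀ : ℤ))) (max L₀ (ℓ₀ : ℤ)) (W W₀ R' WM (N + 1)) := by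
  rw [schedule_core, core]
  exact sBox_symm_mono (L_le L₀ R' ℓ₀ ℓ₁ h.hR k) (W_mono W₀ R' WM hk)

/-- **The prism of the localisation schedule** is the box `{|·_a − c_a| ≤ max L₀ ℓ₀ + R' + ℓ₁, |·_{a'} − c_{a'}| ≤ W (N+1) + R' + WM}`. [folklore] -/
theorem schedule_prism : (schedule h a c N).prism =
    sBox a 1 c (-(max L₀ (ℓ₀ : ℤ) + R' + ℓ₁)) (max L₀ (ℓ₀ : ℤ) + R' + ℓ₁) (W W₀ R' WM (N + 1) + R' + WM) := rfl


/-! ### Appended 2026-08-21 (p5-g6): the transverse width in closed form WITHOUT `WM ≤ W₀` (phase 2 of the corridor schedule starts narrower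
than the band spread), and the last core of the localisation schedule in that generality -/

/-- **The transverse width in closed form, any start**: `W (i+1) = max (W₀ + (i+1) R') (WM + i R')`. [this work] -/
theorem W_succ_eq_max (W₀ : ℤ) (R' WM : ℕ) (i : ℕ) : W W₀ R' WM (i + 1) = max (W₀ + ((i : ℤ) + 1) * R') ((WM : ℤ) + (i : ℤ) * R') := by
  induction i with
  | zero => simp [W_succ]
  | succ i ih =>
    rw [W_succ, ih]
    have hR : (0 : ℤ) ≤ (R' : ℤ) := Int.natCast_nonneg _
    have hi : (0 : ℤ) ≤ (i : ℤ) := Int.natCast_nonneg _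
    push_cast
    rcases le_total (W₀ + ((i : ℤ) + 1) * R') ((WM : ℤ) + (i : ℤ) * R') with h1 | h1
    · rw [max_eq_right h1]
      rw [max_eq_left (by nlinarith), max_eq_right (by nlinarith)]
      ring
    · rw [max_eq_left h1]
      rcases le_total (W₀ + ((i : ℤ) + 1) * R' + R') (WM : ℤ) with h2 | h2
      · -- impossible unless `R' = 0`-ish; handle uniformly
        rw [max_eq_right h2]
        refine le_antisymm ?_ ?_
        · exact le_max_of_le_right (by nlinarith)
        · exact max_le (by nlinarith) (by nlinarith)
      · rw [max_eq_left h2]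
        rw [max_eq_left (by nlinarith)]
        ring

/-- **The last core after enough rounds, any spread**: `L₀ ≤ (N+1)(ℓ₁ − R') + ℓ₀` gives
`core (N+1) = {|·_a − c_a| ≤ ℓ₀, |·_{a'} − c_{a'}| ≤ max (W₀ + (N+1) R') (WM + N R')}`. [cite: KozmaNitzan2024, §4 Lemma 12 (pp. 23–25)] -/
theorem schedule_core_last' (hN : L₀ ≤ ((N : ℤ) + 1) * (ℓ₁ - R') + ℓ₀) :
    (schedule h a c N).core (N + 1) = sBox a 1 c (-(ℓ₀ : ℤ)) ℓ₀ (max (W₀ + ((N : ℤ) + 1) * R') ((WM : ℤ) + (N : ℤ) * R')) := by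
  rw [schedule_core, core, L_eq_ℓ₀ L₀ R' ℓ₀ ℓ₁ h.hR (by omega) (by push_cast; linarith), W_succ_eq_max]

include h in
/-- **How many rounds are enough**: any `N` with `L₀ − ℓ₀ ≤ (N + 1) (ℓ₁ − R')`; in particular `N + 1 := ⌈(L₀ − ℓ₀)/(ℓ₁ − R')⌉` when `R' < ℓ₁`.
(Restated as the along-width bound it yields.) [folklore] -/
theorem L_last_eq_ℓ₀ (hN : L₀ ≤ ((N : ℤ) + 1) * (ℓ₁ - R') + ℓ₀) : L L₀ R' ℓ₀ ℓ₁ (N + 1) = ℓ₀ :=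
  L_eq_ℓ₀ L₀ R' ℓ₀ ℓ₁ h.hR (by omega) (by push_cast; linarith)

end Loc

end ChainPlanar

end Transplant

end Summit.CriticalPhenomena.PercolationContinuityZ3.Theorems

end
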